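import Summits.MatrixMultiplication.OmegaCensus.STPPVosperCoverSearchW
import Summits.MatrixMultiplication.OmegaCensus.STPPVosperSlackOneCoverSteps

/-!
# ω-census (abelian STPP census): words-cover rows for `{(2,2,3),(3,4,2),(4,3,2)} ⊄ ℤ₅₉` — case α₂, `j = 30`, `ℓ₁ = 5` (kernel computations)

HONEST FRAMING (pub-omega census; verbatim): lottery ticket; floor = certified bounds/negative ranges.
Census STRUCTURE (seat pub-omega-stpp-2 gen 25, 2026-08-28), family (b2).  Row file for the kill of the `ℤ₅₉` leaf `{(2,2,3),(3,4,2),(4,3,2)}` by the slack-1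
law for `a = 2` WITH WORDS (`no_isSTPP_of_slack_one_coverW_prime_a2`, `STPPVosperSlackOneCoverLawA2W.lean`): reading `(a,b,c) = (2,4,3)` at the `(4,3,2)` block of
the family `(C, A, B)`, other blocks `(2,3,4)`, `(3,2,2)` (searched big block first), `(z, L, vol, m, n) = (14, 16, 24, 17, 41)`, word target `{0, ±1, ±2, ±3}`,
survivors `29, 30 = ±2⁻¹` in cases α₂ and β.  The PLAIN cover stage does not close this leaf (exact covers exist); the Def-5.1 words among the two other blocks
do: every search below is `coverSearchW` (`STPPVosperCoverSearchW.lean`) run Z-FIRST (sizes `(3,2,4),(2,3,2)`), ≈ 1.3–1.6·10⁶ mirror steps ≈ 35–45 s each in the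
kernel (python mirror HOME `pub-omega-stpp-2-g25/code/pilot/cover_wfull.py`).  Nothing here is progress on `ω`.
-/

namespace Summit.MatrixMultiplication.OmegaCensus.CubeNB

/-- Case α₂, `j = 30`, `ℓ₁ = 5`, offset `δ = 3`: the Z-first words search fails. [folklore] -/
theorem cw342_a2_j30_l5_d3 : coverSearchW 59 (List.range 14) (twoRunVals 59 30 5 3 16) [(3, 2, 4), (2, 3, 2)] = false := by
  decide +kernel

/-- Case α₂, `j = 30`, `ℓ₁ = 5`, offset `δ = 7`: the Z-first words search fails. [folklore] -/
theorem cw342_a2_j30_l5_d7 : coverSearchW 59 (List.range 14) (twoRunVals 59 30 5 7 16) [(3, 2, 4), (2, 3, 2)] = false := by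
  decide +kernel

/-- Case α₂, `j = 30`, `ℓ₁ = 5`, offset `δ = 49`: the Z-first words search fails. [folklore] -/
theorem cw342_a2_j30_l5_d49 : coverSearchW 59 (List.range 14) (twoRunVals 59 30 5 49 16) [(3, 2, 4), (2, 3, 2)] = false := by
  decide +kernel

/-- Case α₂, `j = 30`, `ℓ₁ = 5`, offset `δ = 53`: the Z-first words search fails. [folklore] -/
theorem cw342_a2_j30_l5_d53 : coverSearchW 59 (List.range 14) (twoRunVals 59 30 5 53 16) [(3, 2, 4), (2, 3, 2)] = false := by
  decide +kernel

end Summit.MatrixMultiplication.OmegaCensus.CubeNB
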